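import Summits.NavierStokesRegularity.NavierStokesRegularity.Theses.FilamentSkeletonRss
import Literature.Analysis.FluidPDE.GaussianVortexPlanarProofs
import Summits.AnomalousDissipation.AnomalousDissipation.Theorems.MarginalStabilityChainStretchedVortexRowsStubCoreRotationLocalSkew

/-!
# Tools A for stub `stub_oddAttenuation` of crux `CoreLinearInvertibility`
# (stmt-NavierStokesRegularity-17973), line `Sketch`: decay classes and whole-plane integration by parts

Bookkeeping for the odd-sector attenuation estimate (flat `L²` after the ground-state conjugation
`ũ = e^{(1−λ)|x|²/8} v`): pointwise classes `|F| ≤ C (1+|x|)ᴺ` (polynomial) and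
`|F| ≤ C (1+|x|)ᴺ e^{−k|x|²}` (Gaussian decay of rate `k`), their closure under sums and products,
integrability for `k ≥ 1/4` (comparison with the moments `∫ (1+|x|)ᴺ G < ∞` of the Gaussian vortex
profile, `e^{−|x|²/4} = 4π G`), and the boundary-free integration by parts `∫ ∂ᵥ h = 0` for
`h ∈ C¹ ∩ L¹` with `∂ᵥh ∈ L¹` (Mathlib `integral_mul_fderiv_eq_neg_fderiv_mul_of_integrable`
against the constant `1`); finally the decay classes of `∂ᵥu, ∂_θu, D²u[v][w], D²u[v][x^⊥]`
for `u ∈ C²` with `u, Du, D²u` of decay `e^{−|x|²/8}`, and their continuity.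
-/

set_option linter.dupNamespace false

noncomputable section

namespace Summit.NavierStokesRegularity.NavierStokesRegularity.Theorems

open MeasureTheory Filter Topology Set
open Literature.Analysis.FluidPDE
open Summit.AnomalousDissipation.AnomalousDissipation.Theorems.MarginalStabilityChainStretchedVortexRows
open scoped InnerProductSpace

/-! ### Polynomially bounded functions on `ℝ²` -/

/-- Constants are polynomially bounded. [folklore] -/
theorem polyBound_const (c : ℝ) :
    ∃ (C : ℝ) (N : ℕ), ∀ x : EuclideanSpace ℝ (Fin 2), |c| ≤ C * (1 + ‖x‖) ^ N :=
  ⟨|c|, 0, fun x => by simp⟩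

/-- Coordinates are polynomially bounded: `|xᵢ| ≤ 1 + |x|`. [folklore] -/
theorem polyBound_coord (i : Fin 2) :
    ∃ (C : ℝ) (N : ℕ), ∀ x : EuclideanSpace ℝ (Fin 2), |x i| ≤ C * (1 + ‖x‖) ^ N :=
  ⟨1, 1, fun x => by
    have h : |x i| ≤ ‖x‖ := by simpa [Real.norm_eq_abs] using PiLp.norm_apply_le x i
    rw [one_mul, pow_one]
    linarith [norm_nonneg x]⟩

/-- The norm is polynomially bounded: `|x| ≤ 1 + |x|`. [folklore] -/
theorem polyBound_norm :
    ∃ (C : ℝ) (N : ℕ), ∀ x : EuclideanSpace ℝ (Fin 2), |‖x‖| ≤ C * (1 + ‖x‖) ^ N :=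
  ⟨1, 1, fun x => by rw [abs_norm, one_mul, pow_one]; linarith [norm_nonneg x]⟩

/-- Products (up to a pointwise bound) of polynomially bounded functions. [folklore] -/
theorem polyBound_of_le_mul {P Q H : EuclideanSpace ℝ (Fin 2) → ℝ}
    (hP : ∃ (C : ℝ) (N : ℕ), ∀ x, |P x| ≤ C * (1 + ‖x‖) ^ N)
    (hQ : ∃ (C : ℝ) (N : ℕ), ∀ x, |Q x| ≤ C * (1 + ‖x‖) ^ N)
    (h : ∀ x, |H x| ≤ |P x| * |Q x|) :
    ∃ (C : ℝ) (N : ℕ), ∀ x, |H x| ≤ C * (1 + ‖x‖) ^ N := by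
  obtain ⟨C, N, hC⟩ := hP
  obtain ⟨D, M, hD⟩ := hQ
  refine ⟨C * D, N + M, fun x => (h x).trans ?_⟩
  calc |P x| * |Q x| ≤ (C * (1 + ‖x‖) ^ N) * (D * (1 + ‖x‖) ^ M) :=
        mul_le_mul (hC x) (hD x) (abs_nonneg _) ((abs_nonneg _).trans (hC x))
    _ = C * D * (1 + ‖x‖) ^ (N + M) := by ring

/-- Sums (up to a pointwise bound) of polynomially bounded functions. [folklore] -/
theorem polyBound_of_le_add {P Q H : EuclideanSpace ℝ (Fin 2) → ℝ}
    (hP : ∃ (C : ℝ) (N : ℕ), ∀ x, |P x| ≤ C * (1 + ‖x‖) ^ N)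
    (hQ : ∃ (C : ℝ) (N : ℕ), ∀ x, |Q x| ≤ C * (1 + ‖x‖) ^ N)
    (h : ∀ x, |H x| ≤ |P x| + |Q x|) :
    ∃ (C : ℝ) (N : ℕ), ∀ x, |H x| ≤ C * (1 + ‖x‖) ^ N := by
  obtain ⟨C, N, hC⟩ := hP
  obtain ⟨D, M, hD⟩ := hQ
  have hC0 : 0 ≤ C := by
    have := (abs_nonneg _).trans (hC 0); simpa using this
  have hD0 : 0 ≤ D := by
    have := (abs_nonneg _).trans (hD 0); simpa using this
  refine ⟨C + D, N + M, fun x => (h x).trans ?_⟩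
  have h1 : (1 : ℝ) ≤ 1 + ‖x‖ := by linarith [norm_nonneg x]
  have hN : (1 + ‖x‖) ^ N ≤ (1 + ‖x‖) ^ (N + M) := pow_le_pow_right₀ h1 (Nat.le_add_right N M)
  have hM : (1 + ‖x‖) ^ M ≤ (1 + ‖x‖) ^ (N + M) := pow_le_pow_right₀ h1 (Nat.le_add_left M N)
  calc |P x| + |Q x| ≤ C * (1 + ‖x‖) ^ N + D * (1 + ‖x‖) ^ M := add_le_add (hC x) (hD x)
    _ ≤ C * (1 + ‖x‖) ^ (N + M) + D * (1 + ‖x‖) ^ (N + M) := by gcongr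
    _ = (C + D) * (1 + ‖x‖) ^ (N + M) := by ring

/-! ### Gaussian decay classes `|F| ≤ C (1+|x|)ᴺ e^{−k|x|²}` -/

/-- A polynomially bounded function times a function of Gaussian decay `k` has decay `k`. [folklore] -/
theorem gaussDecay_of_le_poly_mul {P F H : EuclideanSpace ℝ (Fin 2) → ℝ} {k : ℝ}
    (hP : ∃ (C : ℝ) (N : ℕ), ∀ x, |P x| ≤ C * (1 + ‖x‖) ^ N)
    (hF : ∃ (C : ℝ) (N : ℕ), ∀ x, |F x| ≤ C * (1 + ‖x‖) ^ N * Real.exp (-(k * ‖x‖ ^ 2)))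
    (h : ∀ x, |H x| ≤ |P x| * |F x|) :
    ∃ (C : ℝ) (N : ℕ), ∀ x, |H x| ≤ C * (1 + ‖x‖) ^ N * Real.exp (-(k * ‖x‖ ^ 2)) := by
  obtain ⟨C, N, hC⟩ := hP
  obtain ⟨D, M, hD⟩ := hF
  refine ⟨C * D, N + M, fun x => (h x).trans ?_⟩
  calc |P x| * |F x| ≤ (C * (1 + ‖x‖) ^ N) * (D * (1 + ‖x‖) ^ M * Real.exp (-(k * ‖x‖ ^ 2))) :=
        mul_le_mul (hC x) (hD x) (abs_nonneg _) ((abs_nonneg _).trans (hC x))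
    _ = C * D * (1 + ‖x‖) ^ (N + M) * Real.exp (-(k * ‖x‖ ^ 2)) := by ring

/-- The product (up to a pointwise bound) of two functions of Gaussian decay `k` has decay `2k`. [folklore] -/
theorem gaussDecay_of_le_mul {F G H : EuclideanSpace ℝ (Fin 2) → ℝ} {k : ℝ}
    (hF : ∃ (C : ℝ) (N : ℕ), ∀ x, |F x| ≤ C * (1 + ‖x‖) ^ N * Real.exp (-(k * ‖x‖ ^ 2)))
    (hG : ∃ (C : ℝ) (N : ℕ), ∀ x, |G x| ≤ C * (1 + ‖x‖) ^ N * Real.exp (-(k * ‖x‖ ^ 2)))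
    (h : ∀ x, |H x| ≤ |F x| * |G x|) :
    ∃ (C : ℝ) (N : ℕ), ∀ x, |H x| ≤ C * (1 + ‖x‖) ^ N * Real.exp (-(2 * k * ‖x‖ ^ 2)) := by
  obtain ⟨C, N, hC⟩ := hF
  obtain ⟨D, M, hD⟩ := hG
  refine ⟨C * D, N + M, fun x => (h x).trans ?_⟩
  have he : Real.exp (-(k * ‖x‖ ^ 2)) * Real.exp (-(k * ‖x‖ ^ 2)) =
      Real.exp (-(2 * k * ‖x‖ ^ 2)) := by
    rw [← Real.exp_add]; ring_nf
  calc |F x| * |G x| ≤ (C * (1 + ‖x‖) ^ N * Real.exp (-(k * ‖x‖ ^ 2))) *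
        (D * (1 + ‖x‖) ^ M * Real.exp (-(k * ‖x‖ ^ 2))) :=
        mul_le_mul (hC x) (hD x) (abs_nonneg _) ((abs_nonneg _).trans (hC x))
    _ = C * D * (1 + ‖x‖) ^ (N + M) *
        (Real.exp (-(k * ‖x‖ ^ 2)) * Real.exp (-(k * ‖x‖ ^ 2))) := by ring
    _ = C * D * (1 + ‖x‖) ^ (N + M) * Real.exp (-(2 * k * ‖x‖ ^ 2)) := by rw [he]

/-- Sums (up to a pointwise bound) within a Gaussian decay class. [folklore] -/
theorem gaussDecay_of_le_add {F G H : EuclideanSpace ℝ (Fin 2) → ℝ} {k : ℝ}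
    (hF : ∃ (C : ℝ) (N : ℕ), ∀ x, |F x| ≤ C * (1 + ‖x‖) ^ N * Real.exp (-(k * ‖x‖ ^ 2)))
    (hG : ∃ (C : ℝ) (N : ℕ), ∀ x, |G x| ≤ C * (1 + ‖x‖) ^ N * Real.exp (-(k * ‖x‖ ^ 2)))
    (h : ∀ x, |H x| ≤ |F x| + |G x|) :
    ∃ (C : ℝ) (N : ℕ), ∀ x, |H x| ≤ C * (1 + ‖x‖) ^ N * Real.exp (-(k * ‖x‖ ^ 2)) := by
  obtain ⟨C, N, hC⟩ := hF
  obtain ⟨D, M, hD⟩ := hG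
  have hC0 : 0 ≤ C := by
    have := (abs_nonneg _).trans (hC 0); simpa using this
  have hD0 : 0 ≤ D := by
    have := (abs_nonneg _).trans (hD 0); simpa using this
  refine ⟨C + D, N + M, fun x => (h x).trans ?_⟩
  have h1 : (1 : ℝ) ≤ 1 + ‖x‖ := by linarith [norm_nonneg x]
  have hN : (1 + ‖x‖) ^ N ≤ (1 + ‖x‖) ^ (N + M) := pow_le_pow_right₀ h1 (Nat.le_add_right N M)
  have hM : (1 + ‖x‖) ^ M ≤ (1 + ‖x‖) ^ (N + M) := pow_le_pow_right₀ h1 (Nat.le_add_left M N)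
  have hE := (Real.exp_pos (-(k * ‖x‖ ^ 2))).le
  calc |F x| + |G x| ≤ C * (1 + ‖x‖) ^ N * Real.exp (-(k * ‖x‖ ^ 2)) +
        D * (1 + ‖x‖) ^ M * Real.exp (-(k * ‖x‖ ^ 2)) := add_le_add (hC x) (hD x)
    _ ≤ C * (1 + ‖x‖) ^ (N + M) * Real.exp (-(k * ‖x‖ ^ 2)) +
        D * (1 + ‖x‖) ^ (N + M) * Real.exp (-(k * ‖x‖ ^ 2)) := by gcongr
    _ = (C + D) * (1 + ‖x‖) ^ (N + M) * Real.exp (-(k * ‖x‖ ^ 2)) := by ring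

/-- A polynomially bounded function times two functions of Gaussian decay `k` (up to a pointwise
bound) has decay `2k` — the shape of every integrand of the energy method. [folklore] -/
theorem gaussDecay_of_le_poly_mul_mul {P F G H : EuclideanSpace ℝ (Fin 2) → ℝ} {k : ℝ}
    (hP : ∃ (C : ℝ) (N : ℕ), ∀ x, |P x| ≤ C * (1 + ‖x‖) ^ N)
    (hF : ∃ (C : ℝ) (N : ℕ), ∀ x, |F x| ≤ C * (1 + ‖x‖) ^ N * Real.exp (-(k * ‖x‖ ^ 2)))
    (hG : ∃ (C : ℝ) (N : ℕ), ∀ x, |G x| ≤ C * (1 + ‖x‖) ^ N * Real.exp (-(k * ‖x‖ ^ 2)))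
    (h : ∀ x, |H x| ≤ |P x| * |F x| * |G x|) :
    ∃ (C : ℝ) (N : ℕ), ∀ x, |H x| ≤ C * (1 + ‖x‖) ^ N * Real.exp (-(2 * k * ‖x‖ ^ 2)) :=
  gaussDecay_of_le_mul (gaussDecay_of_le_poly_mul hP hF (H := fun x => P x * F x)
    (fun x => (abs_mul _ _).le)) hG (fun x => by rw [abs_mul]; exact h x)

/-- A Gaussian decay class is closed under pointwise domination. [folklore] -/
theorem gaussDecay_of_le {F H : EuclideanSpace ℝ (Fin 2) → ℝ} {k : ℝ}
    (hF : ∃ (C : ℝ) (N : ℕ), ∀ x, |F x| ≤ C * (1 + ‖x‖) ^ N * Real.exp (-(k * ‖x‖ ^ 2)))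
    (h : ∀ x, |H x| ≤ |F x|) :
    ∃ (C : ℝ) (N : ℕ), ∀ x, |H x| ≤ C * (1 + ‖x‖) ^ N * Real.exp (-(k * ‖x‖ ^ 2)) := by
  obtain ⟨C, N, hC⟩ := hF
  exact ⟨C, N, fun x => (h x).trans (hC x)⟩

/-- **Integrability of the Gaussian decay classes of rate `k ≥ 1/4`**: a continuous `F` with
`|F| ≤ C(1+|x|)ᴺ e^{−k|x|²}` is integrable (`e^{−|x|²/4} = 4πG` and `∫ (1+|x|)ᴺ G < ∞`). [folklore] -/
theorem integrable_of_gaussDecay {F : EuclideanSpace ℝ (Fin 2) → ℝ} {k : ℝ} (hk : 1 / 4 ≤ k)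
    (hFc : Continuous F)
    (hF : ∃ (C : ℝ) (N : ℕ), ∀ x, |F x| ≤ C * (1 + ‖x‖) ^ N * Real.exp (-(k * ‖x‖ ^ 2))) :
    Integrable F := by
  obtain ⟨C, N, hC⟩ := hF
  have hC0 : 0 ≤ C := by
    have := (abs_nonneg _).trans (hC 0); simpa using this
  refine integrable_of_le_one_add_norm_pow_mul_gauss hFc (A := 4 * Real.pi * C) (N := N) fun x => ?_
  rw [Real.norm_eq_abs]
  refine (hC x).trans ?_
  have hexp : Real.exp (-(k * ‖x‖ ^ 2)) ≤ 4 * Real.pi * gaussVortexProfile x := by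
    rw [gaussVortexProfile, ← mul_assoc, mul_inv_cancel₀ (by positivity), one_mul]
    exact Real.exp_le_exp.2 (by nlinarith [sq_nonneg ‖x‖])
  calc C * (1 + ‖x‖) ^ N * Real.exp (-(k * ‖x‖ ^ 2))
      ≤ C * (1 + ‖x‖) ^ N * (4 * Real.pi * gaussVortexProfile x) := by gcongr
    _ = 4 * Real.pi * C * ((1 + ‖x‖) ^ N * gaussVortexProfile x) := by ring

/-! ### Integration by parts on the whole plane, no boundary terms -/

/-- **`∫ ∂ᵥ h = 0`** for `h ∈ C¹(ℝ²)` with `h` and `∂ᵥh` integrable (Mathlib's integration by parts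
for integrable products, against the constant function `1`). [folklore] -/
theorem integral_fderiv_apply_eq_zero_of_integrable {h : EuclideanSpace ℝ (Fin 2) → ℝ}
    (hh : ContDiff ℝ 1 h) (hi : Integrable h) (v : EuclideanSpace ℝ (Fin 2))
    (hdi : Integrable fun x => fderiv ℝ h x v) : ∫ x, fderiv ℝ h x v = 0 := by
  have key := integral_mul_fderiv_eq_neg_fderiv_mul_of_integrable (μ := volume)
    (f := fun _ : EuclideanSpace ℝ (Fin 2) => (1 : ℝ)) (g := h) (v := v) ?_ ?_ ?_ ?_ ?_
  · simpa using key
  · simp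
  · simpa using hdi
  · simpa using hi
  · exact fun x _ => differentiableAt_const _
  · exact fun x _ => hh.differentiable one_ne_zero x

/-- **The divergence trick behind every identity of the energy method**: if `h ∈ C¹ ∩ L¹` and
`∂ᵥh = a + b` pointwise with `a, b ∈ L¹`, then `∫ b = −∫ a`. [folklore] -/
theorem integral_eq_neg_integral_of_fderiv_eq_add {h a b : EuclideanSpace ℝ (Fin 2) → ℝ}
    (hh : ContDiff ℝ 1 h) (hi : Integrable h) (v : EuclideanSpace ℝ (Fin 2))
    (ha : Integrable a) (hb : Integrable b) (hab : ∀ x, fderiv ℝ h x v = a x + b x) :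
    ∫ x, b x = -∫ x, a x := by
  have hdi : Integrable fun x => fderiv ℝ h x v := (ha.add hb).congr (Eventually.of_forall fun x =>
    (hab x).symm)
  have h0 := integral_fderiv_apply_eq_zero_of_integrable hh hi v hdi
  simp_rw [hab] at h0
  rw [integral_add ha hb] at h0
  linarith

/-! ### Small calculus facts on `ℝ²` -/

/-- `∂ᵥ(xⱼ g) = vⱼ g + xⱼ ∂ᵥg`. [folklore] -/
theorem fderiv_coord_mul_apply {g : EuclideanSpace ℝ (Fin 2) → ℝ} {x : EuclideanSpace ℝ (Fin 2)}
    (hg : DifferentiableAt ℝ g x) (j : Fin 2) (v : EuclideanSpace ℝ (Fin 2)) :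
    fderiv ℝ (fun y => y j * g y) x v = v j * g x + x j * fderiv ℝ g x v := by
  have hc : HasFDerivAt (fun y : EuclideanSpace ℝ (Fin 2) => y j)
      (EuclideanSpace.proj j : EuclideanSpace ℝ (Fin 2) →L[ℝ] ℝ) x :=
    (EuclideanSpace.proj j : EuclideanSpace ℝ (Fin 2) →L[ℝ] ℝ).hasFDerivAt
  rw [(hc.fun_mul hg.hasFDerivAt).fderiv]
  simp
  ring

/-- `xⱼ g` is `C¹` for `g ∈ C¹`. [folklore] -/
theorem contDiff_coord_mul {g : EuclideanSpace ℝ (Fin 2) → ℝ} {n : WithTop ℕ∞} (hg : ContDiff ℝ n g)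
    (j : Fin 2) : ContDiff ℝ n fun y => y j * g y :=
  ((EuclideanSpace.proj j : EuclideanSpace ℝ (Fin 2) →L[ℝ] ℝ).contDiff).mul hg

/-- `e₀^⊥ = e₁`. [folklore] -/
theorem perp_single_zero_eq :
    perp (EuclideanSpace.single (0 : Fin 2) (1 : ℝ)) = EuclideanSpace.single (1 : Fin 2) (1 : ℝ) := by
  ext i; fin_cases i <;> simp [perp]

/-- `e₁^⊥ = −e₀`. [folklore] -/
theorem perp_single_one_eq :
    perp (EuclideanSpace.single (1 : Fin 2) (1 : ℝ)) = -EuclideanSpace.single (0 : Fin 2) (1 : ℝ) := by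
  ext i; fin_cases i <;> simp [perp]

section Decay

variable {u : EuclideanSpace ℝ (Fin 2) → ℝ} (hu : ContDiff ℝ 2 u)
  (hB : ∃ (C : ℝ) (N : ℕ), ∀ x, |u x| ≤ C * (1 + ‖x‖) ^ N * Real.exp (-(1 / 8 * ‖x‖ ^ 2)) ∧
      ‖fderiv ℝ u x‖ ≤ C * (1 + ‖x‖) ^ N * Real.exp (-(1 / 8 * ‖x‖ ^ 2)) ∧
      ‖fderiv ℝ (fderiv ℝ u) x‖ ≤ C * (1 + ‖x‖) ^ N * Real.exp (-(1 / 8 * ‖x‖ ^ 2)))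

/-! ### The decay class of `u` and its derivatives -/

include hB in
/-- `u` has Gaussian decay `1/8`. [folklore] -/
theorem gaussDecay_self :
    ∃ (C : ℝ) (N : ℕ), ∀ x, |u x| ≤ C * (1 + ‖x‖) ^ N * Real.exp (-(1 / 8 * ‖x‖ ^ 2)) := by
  obtain ⟨C, N, h⟩ := hB
  exact ⟨C, N, fun x => (h x).1⟩

include hB in
/-- `∂ᵥu` has Gaussian decay `1/8`. [folklore] -/
theorem gaussDecay_fderiv_apply (v : EuclideanSpace ℝ (Fin 2)) :
    ∃ (C : ℝ) (N : ℕ), ∀ x, |fderiv ℝ u x v| ≤ C * (1 + ‖x‖) ^ N * Real.exp (-(1 / 8 * ‖x‖ ^ 2)) := by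
  obtain ⟨C, N, h⟩ := hB
  refine ⟨C * ‖v‖, N, fun x => ?_⟩
  calc |fderiv ℝ u x v| ≤ ‖fderiv ℝ u x‖ * ‖v‖ := by
        rw [← Real.norm_eq_abs]; exact ContinuousLinearMap.le_opNorm _ _
    _ ≤ C * (1 + ‖x‖) ^ N * Real.exp (-(1 / 8 * ‖x‖ ^ 2)) * ‖v‖ :=
        mul_le_mul_of_nonneg_right (h x).2.1 (norm_nonneg _)
    _ = C * ‖v‖ * (1 + ‖x‖) ^ N * Real.exp (-(1 / 8 * ‖x‖ ^ 2)) := by ring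

include hB in
/-- `∂_θu = Du[x^⊥]` has Gaussian decay `1/8`. [folklore] -/
theorem gaussDecay_fderiv_perp :
    ∃ (C : ℝ) (N : ℕ), ∀ x, |fderiv ℝ u x (perp x)| ≤
      C * (1 + ‖x‖) ^ N * Real.exp (-(1 / 8 * ‖x‖ ^ 2)) := by
  obtain ⟨C, N, h⟩ := hB
  have hC0 : 0 ≤ C := by
    have := (abs_nonneg _).trans (h 0).1; simpa using this
  refine ⟨C, N + 1, fun x => ?_⟩
  have hx : ‖x‖ ≤ 1 + ‖x‖ := by linarith [norm_nonneg x]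
  calc |fderiv ℝ u x (perp x)| ≤ ‖fderiv ℝ u x‖ * ‖perp x‖ := by
        rw [← Real.norm_eq_abs]; exact ContinuousLinearMap.le_opNorm _ _
    _ ≤ C * (1 + ‖x‖) ^ N * Real.exp (-(1 / 8 * ‖x‖ ^ 2)) * (1 + ‖x‖) := by
        rw [norm_perp]
        exact mul_le_mul (h x).2.1 hx (norm_nonneg _) (by positivity)
    _ = C * (1 + ‖x‖) ^ (N + 1) * Real.exp (-(1 / 8 * ‖x‖ ^ 2)) := by ring

include hB in
/-- `D²u[v][w]` has Gaussian decay `1/8`. [folklore] -/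
theorem gaussDecay_fderiv_fderiv_apply (v w : EuclideanSpace ℝ (Fin 2)) :
    ∃ (C : ℝ) (N : ℕ), ∀ x, |fderiv ℝ (fderiv ℝ u) x v w| ≤
      C * (1 + ‖x‖) ^ N * Real.exp (-(1 / 8 * ‖x‖ ^ 2)) := by
  obtain ⟨C, N, h⟩ := hB
  refine ⟨C * ‖v‖ * ‖w‖, N, fun x => ?_⟩
  calc |fderiv ℝ (fderiv ℝ u) x v w| ≤ ‖fderiv ℝ (fderiv ℝ u) x‖ * ‖v‖ * ‖w‖ := by
        rw [← Real.norm_eq_abs]; exact ContinuousLinearMap.le_opNorm₂ _ _ _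
    _ ≤ C * (1 + ‖x‖) ^ N * Real.exp (-(1 / 8 * ‖x‖ ^ 2)) * ‖v‖ * ‖w‖ := by
        gcongr; exact (h x).2.2
    _ = C * ‖v‖ * ‖w‖ * (1 + ‖x‖) ^ N * Real.exp (-(1 / 8 * ‖x‖ ^ 2)) := by ring

include hB in
/-- `D²u[v][x^⊥]` has Gaussian decay `1/8`. [folklore] -/
theorem gaussDecay_fderiv_fderiv_perp (v : EuclideanSpace ℝ (Fin 2)) :
    ∃ (C : ℝ) (N : ℕ), ∀ x, |fderiv ℝ (fderiv ℝ u) x v (perp x)| ≤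
      C * (1 + ‖x‖) ^ N * Real.exp (-(1 / 8 * ‖x‖ ^ 2)) := by
  obtain ⟨C, N, h⟩ := hB
  have hC0 : 0 ≤ C := by
    have := (abs_nonneg _).trans (h 0).1; simpa using this
  refine ⟨C * ‖v‖, N + 1, fun x => ?_⟩
  have hx : ‖x‖ ≤ 1 + ‖x‖ := by linarith [norm_nonneg x]
  calc |fderiv ℝ (fderiv ℝ u) x v (perp x)| ≤ ‖fderiv ℝ (fderiv ℝ u) x‖ * ‖v‖ * ‖perp x‖ := by
        rw [← Real.norm_eq_abs]; exact ContinuousLinearMap.le_opNorm₂ _ _ _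
    _ ≤ C * (1 + ‖x‖) ^ N * Real.exp (-(1 / 8 * ‖x‖ ^ 2)) * ‖v‖ * (1 + ‖x‖) := by
        rw [norm_perp]
        gcongr
        exact (h x).2.2
    _ = C * ‖v‖ * (1 + ‖x‖) ^ (N + 1) * Real.exp (-(1 / 8 * ‖x‖ ^ 2)) := by ring

/-! ### Continuity of the derivatives -/

include hu in
/-- `∂ᵥu` is continuous. [folklore] -/
theorem continuous_fderiv_apply_of_contDiff_two (v : EuclideanSpace ℝ (Fin 2)) :
    Continuous fun x => fderiv ℝ u x v :=
  (hu.continuous_fderiv two_ne_zero).clm_apply continuous_const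

include hu in
/-- `∂_θu` is continuous. [folklore] -/
theorem continuous_fderiv_perp_of_contDiff_two : Continuous fun x => fderiv ℝ u x (perp x) :=
  (hu.continuous_fderiv two_ne_zero).clm_apply continuous_perp

include hu in
/-- `D²u[v][w]` is continuous. [folklore] -/
theorem continuous_fderiv_fderiv_apply_of_contDiff_two (v w : EuclideanSpace ℝ (Fin 2)) :
    Continuous fun x => fderiv ℝ (fderiv ℝ u) x v w :=
  (((hu.fderiv_right (m := 1) le_rfl).continuous_fderiv one_ne_zero).clm_apply
    continuous_const).clm_apply continuous_const

include hu in
/-- `D²u[v][x^⊥]` is continuous. [folklore] -/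
theorem continuous_fderiv_fderiv_perp_of_contDiff_two (v : EuclideanSpace ℝ (Fin 2)) :
    Continuous fun x => fderiv ℝ (fderiv ℝ u) x v (perp x) :=
  (((hu.fderiv_right (m := 1) le_rfl).continuous_fderiv one_ne_zero).clm_apply
    continuous_const).clm_apply continuous_perp

end Decay

/-- Registered tools stub of crux stmt-NavierStokesRegularity-17973 (`stub_oddAttenuationToolsA`):
integrability of the Gaussian decay classes, `∫ ∂ᵥh = 0` without boundary terms, the divergence
trick `∂ᵥh = a + b ⇒ ∫ b = −∫ a`, and `∂ᵥ(xⱼ g) = vⱼ g + xⱼ ∂ᵥg`. [folklore] -/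
theorem stub_oddAttenuationToolsA :
    (∀ (F : EuclideanSpace ℝ (Fin 2) → ℝ) (k : ℝ), 1 / 4 ≤ k → Continuous F →
      (∃ (C : ℝ) (N : ℕ), ∀ x, |F x| ≤ C * (1 + ‖x‖) ^ N * Real.exp (-(k * ‖x‖ ^ 2))) →
      Integrable F) ∧
    (∀ (h : EuclideanSpace ℝ (Fin 2) → ℝ), ContDiff ℝ 1 h → Integrable h →
      ∀ v : EuclideanSpace ℝ (Fin 2), Integrable (fun x => fderiv ℝ h x v) →
      ∫ x, fderiv ℝ h x v = 0) ∧
    (∀ (h a b : EuclideanSpace ℝ (Fin 2) → ℝ), ContDiff ℝ 1 h → Integrable h →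
      ∀ v : EuclideanSpace ℝ (Fin 2), Integrable a → Integrable b →
      (∀ x, fderiv ℝ h x v = a x + b x) → ∫ x, b x = -∫ x, a x) ∧
    (∀ (g : EuclideanSpace ℝ (Fin 2) → ℝ) (x : EuclideanSpace ℝ (Fin 2)), DifferentiableAt ℝ g x →
      ∀ (j : Fin 2) (v : EuclideanSpace ℝ (Fin 2)),
      fderiv ℝ (fun y => y j * g y) x v = v j * g x + x j * fderiv ℝ g x v) :=
  ⟨fun _ _ hk hF h => integrable_of_gaussDecay hk hF h,
    fun _ hh hi v hdi => integral_fderiv_apply_eq_zero_of_integrable hh hi v hdi,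
    fun _ _ _ hh hi v ha hb hab => integral_eq_neg_integral_of_fderiv_eq_add hh hi v ha hb hab,
    fun _ _ hg j v => fderiv_coord_mul_apply hg j v⟩

end Summit.NavierStokesRegularity.NavierStokesRegularity.Theorems
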